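import Mathlib
import Literature.Computability.AlgebraicComplexity.MatMulRankLowerBoundsProofs

/-!
# Koszul witness for `DiagonalPowerDecay` (stmt-MatrixMultiplication-14053), part 1: the isometric twirl

Support file for the quantitative `p = 1` Koszul-flattening fidelity witness
`|⟨S, ⟨n,n,n⟩⟩|² ≤ n (2r + 3n² + n (n % 2)) / 6 · ‖S‖²` for `R(S) ≤ r` (files `…KoszulWitnessSpectral`,
`…KoszulWitness`).  This part builds the family of projections `Φ_w : ℂ^{n×n} → ℂ³`, `w ∈ [n]²`, used to
Koszul-flatten the first factor, and proves that the family is an `L²`-ISOMETRIC TWIRL (a tight frame):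

  `∑_w ∑_j conj(Φ_w x)_j (Φ_w y)_j = 3n · ∑_a conj(x a) y a`        (`kwProj_frame`).

`Φ_w = Φ ∘ (W_w ⊗ 1)` where `W_w`, `w = (s, t)`, is the clock-and-shift unitary
`W_w(a, b) = [a = b + s] e(t b)` (`e` the standard additive character of `ℤ/n`, `kwShift`) acting on the
row index `κ` of `x_{κν}`, and `Φ(x)_j = ∑_{κν} β_j(κ,ν) x_{κν}` with the three coefficient patterns
(`kwBeta`) `β₀ = [κ = ν]·(√3 on the `Fin.rev`-fixed point, else 1)`, `β₁ = [ν = rev κ ≠ κ]`,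
`β₂ = [κ = ν ≠ rev κ]·d_κ`, `d_κ = ±1` the half-sign (`kwSgn`, `d_{rev κ} = -d_κ`): an anticommuting
Pauli pair `(P_rev, D)` on the `rev`-orbits of size two.  The frame identity rests on the completeness
relation of the `n²` unitaries `W_w` (`kwShift_complete`) and on `∑_j β_j^† β_j = 3·1` (`kwBeta_frame`).

References: J. M. Landsberg, G. Ottaviani, Theory of Computing 11 (2015) (Koszul flattenings);
V. Strassen, J. reine angew. Math. 375/376 (1987) (commutator equations); folklore (Weyl–Heisenberg
clock-and-shift basis, Pauli matrices).
-/

set_option linter.dupNamespace false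

noncomputable section

namespace Summit.MatrixMultiplication.MatrixMultiplication.Theorems.DiagonalPowerDecay

open scoped BigOperators ComplexConjugate
open Literature.Computability.AlgebraicComplexity

variable {n : ℕ}

/-! ## The clock-and-shift unitaries -/

/-- The clock-and-shift unitary `W_{(s,t)}(a,b) = [a = b + s]·e(t·b)` on `ℂ^n` (`e` = the standard
additive character of `ℤ/n`, indices transported along `Fin n ≃ ZMod n`). [folklore] -/
def kwShift [NeZero n] (w : Fin n × Fin n) (a b : Fin n) : ℂ :=
  if a = b + w.1 then (ZMod.stdAddChar (ZMod.finEquiv n w.2 * ZMod.finEquiv n b) : ℂ) else 0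

/-- `e(x) · conj(e(x)) = 1` for the standard additive character. [folklore] -/
theorem stdAddChar_mul_conj [NeZero n] (x : ZMod n) :
    (ZMod.stdAddChar x : ℂ) * conj (ZMod.stdAddChar x : ℂ) = 1 := by
  rw [← AddChar.map_neg_eq_conj, ← AddChar.map_add_eq_mul, add_neg_cancel, AddChar.map_zero_eq_one]

/-- Character orthogonality on `ℤ/n`, summed over `Fin n`: `∑_t e(t̂·d) = n·[d = 0]`. [folklore] -/
theorem sum_stdAddChar_finEquiv_mul [NeZero n] (d : ZMod n) :
    ∑ t : Fin n, (ZMod.stdAddChar (ZMod.finEquiv n t * d) : ℂ) = if d = 0 then (n : ℂ) else 0 := by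
  classical
  rw [Fintype.sum_equiv (ZMod.finEquiv n).toEquiv
    (fun t : Fin n => (ZMod.stdAddChar (ZMod.finEquiv n t * d) : ℂ))
    (fun x : ZMod n => (ZMod.stdAddChar (x * d) : ℂ)) (fun _ => rfl)]
  rw [AddChar.sum_mulShift d (ZMod.isPrimitive_stdAddChar n), ZMod.card]
  split_ifs <;> simp

/-- `a = b + s ↔ b = a - s` in `Fin n`. [folklore] -/
theorem fin_eq_add_iff [NeZero n] (a b s : Fin n) : a = b + s ↔ b = a - s := by
  constructor
  · intro h; exact eq_sub_of_add_eq h.symm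
  · intro h; rw [h, sub_add_cancel]

/-- Rows of `W_w` are orthonormal: `∑_κ W_w(κ₀,κ) conj(W_w(κ₁,κ)) = [κ₀ = κ₁]`. [folklore] -/
theorem kwShift_row_orthonormal [NeZero n] (w : Fin n × Fin n) (κ₀ κ₁ : Fin n) :
    ∑ κ, kwShift w κ₀ κ * conj (kwShift w κ₁ κ) = if κ₀ = κ₁ then 1 else 0 := by
  classical
  have key : ∀ κ : Fin n, kwShift w κ₀ κ * conj (kwShift w κ₁ κ) =
      if κ = κ₀ - w.1 then (if κ₀ = κ₁ then 1 else 0) else 0 := by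
    intro κ
    unfold kwShift
    by_cases h : κ = κ₀ - w.1
    · rw [if_pos h, if_pos ((fin_eq_add_iff κ₀ κ w.1).2 h)]
      by_cases h' : κ₀ = κ₁
      · rw [if_pos h', if_pos ((fin_eq_add_iff κ₁ κ w.1).2 (h' ▸ h)), stdAddChar_mul_conj]
      · rw [if_neg h', if_neg]
        · simp
        · intro h''
          exact h' (((fin_eq_add_iff κ₀ κ w.1).2 h).trans h''.symm)
    · rw [if_neg h, if_neg]
      · simp
      · intro h''; exact h ((fin_eq_add_iff κ₀ κ w.1).1 h'')
  simp_rw [key]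
  rw [Finset.sum_ite_eq' Finset.univ (κ₀ - w.1)]
  simp

/-- Completeness of the clock-and-shift family (it is an orthogonal basis of `n × n` matrices, each of
norm² `n`): `∑_w conj(W_w(a,b)) W_w(c,d) = n·[a = c]·[b = d]`. [folklore] -/
theorem kwShift_complete [NeZero n] (a b c d : Fin n) :
    ∑ w : Fin n × Fin n, conj (kwShift w a b) * kwShift w c d =
      if a = c ∧ b = d then (n : ℂ) else 0 := by
  classical
  rw [Fintype.sum_prod_type]
  have hiff : ∀ (x y s : Fin n), x = y + s ↔ s = x - y := by
    intro x y s
    constructor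
    · intro h; exact eq_sub_of_add_eq' h.symm
    · intro h; rw [h, add_sub_cancel]
  -- inner sum over the clock parameter `t`
  have inner : ∀ s : Fin n, ∑ t : Fin n, conj (kwShift (s, t) a b) * kwShift (s, t) c d =
      if s = a - b then (if a = c ∧ b = d then (n : ℂ) else 0) else 0 := by
    intro s
    unfold kwShift
    simp only
    by_cases hs : s = a - b
    · rw [if_pos hs]
      simp_rw [if_pos ((hiff a b s).2 hs)]
      by_cases hcd : c = d + s
      · simp_rw [if_pos hcd]
        have e1 : ∀ t : Fin n,
            conj (ZMod.stdAddChar (ZMod.finEquiv n t * ZMod.finEquiv n b) : ℂ) *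
              (ZMod.stdAddChar (ZMod.finEquiv n t * ZMod.finEquiv n d) : ℂ) =
            (ZMod.stdAddChar (ZMod.finEquiv n t * (ZMod.finEquiv n d - ZMod.finEquiv n b)) : ℂ) := by
          intro t
          rw [← AddChar.map_neg_eq_conj, ← AddChar.map_add_eq_mul]
          congr 1; ring
        simp_rw [e1]
        rw [sum_stdAddChar_finEquiv_mul]
        have h1 : (ZMod.finEquiv n d - ZMod.finEquiv n b = 0) ↔ b = d := by
          rw [sub_eq_zero, (ZMod.finEquiv n).injective.eq_iff, eq_comm]
        have h2 : (a = c ∧ b = d) ↔ b = d := by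
          constructor
          · exact fun h => h.2
          · intro hbd
            refine ⟨?_, hbd⟩
            rw [(hiff a b s).2 hs, hcd, hbd]
        simp only [h1, h2]
      · have hne : ¬ (a = c ∧ b = d) := by
          rintro ⟨hac, hbd⟩
          apply hcd
          rw [← hac, ← hbd]
          exact (hiff a b s).2 hs
        simp only [hcd, if_false, mul_zero, Finset.sum_const_zero, hne]
    · rw [if_neg hs]
      have ha : ¬ (a = b + s) := fun h => hs ((hiff a b s).1 h)
      simp only [ha, if_false, map_zero, zero_mul, Finset.sum_const_zero]
  simp_rw [inner]
  rw [Finset.sum_ite_eq' Finset.univ (a - b)]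
  simp

/-! ## The Pauli pair on the `Fin.rev`-orbits and the coefficient patterns `β_j` -/

/-- The half-sign `d_κ = +1` if `2κ + 1 < n` and `-1` otherwise; `d_{rev κ} = -d_κ` off the fixed point
of `Fin.rev`. [folklore] -/
def kwSgn (κ : Fin n) : ℂ := if 2 * (κ : ℕ) + 1 < n then 1 else -1

/-- `d_κ² = 1`. [folklore] -/
theorem kwSgn_mul_self (κ : Fin n) : kwSgn κ * kwSgn κ = 1 := by
  unfold kwSgn; split_ifs <;> norm_num

/-- `d_κ` is real. [folklore] -/
@[simp] theorem conj_kwSgn (κ : Fin n) : conj (kwSgn κ) = kwSgn κ := by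
  unfold kwSgn; split_ifs <;> simp

/-- `d_{rev κ} = -d_κ` whenever `rev κ ≠ κ`. [folklore] -/
theorem kwSgn_rev {κ : Fin n} (h : κ.rev ≠ κ) : kwSgn κ.rev = -kwSgn κ := by
  have h1 : ((κ.rev : Fin n) : ℕ) = n - (κ + 1) := Fin.val_rev κ
  have h2 : ((κ.rev : Fin n) : ℕ) ≠ κ := fun e => h (Fin.ext e)
  have hκ : (κ : ℕ) < n := κ.2
  unfold kwSgn
  rw [h1]
  rw [h1] at h2
  by_cases hlt : 2 * (κ : ℕ) + 1 < n
  · rw [if_pos hlt, if_neg (by omega)]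
  · rw [if_neg hlt, if_pos (by omega)]
    norm_num

/-- The three coefficient patterns `β_j(κ, ν)` of `Φ(x)_j = ∑_{κν} β_j(κ,ν) x_{κν}`:
`β₀ = [κ = ν]·(√3 on the fixed point of rev, else 1)`, `β₁ = [ν = rev κ ≠ κ]`, `β₂ = [κ = ν ≠ rev κ]·d_κ`.
[folklore] -/
def kwBeta (κ ν : Fin n) : Fin (2 * 1 + 1) → ℂ :=
  ![if κ = ν then (if κ.rev = κ then ((Real.sqrt 3 : ℝ) : ℂ) else 1) else 0,
    if ν = κ.rev ∧ κ.rev ≠ κ then 1 else 0,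
    if κ = ν ∧ κ.rev ≠ κ then kwSgn κ else 0]

/-- `β₀`. [folklore] -/
@[simp] theorem kwBeta_zero (κ ν : Fin n) :
    kwBeta κ ν 0 = if κ = ν then (if κ.rev = κ then ((Real.sqrt 3 : ℝ) : ℂ) else 1) else 0 := rfl

/-- `β₁`. [folklore] -/
@[simp] theorem kwBeta_one (κ ν : Fin n) :
    kwBeta κ ν 1 = if ν = κ.rev ∧ κ.rev ≠ κ then 1 else 0 := rfl

/-- `β₂`. [folklore] -/
@[simp] theorem kwBeta_two (κ ν : Fin n) :
    kwBeta κ ν 2 = if κ = ν ∧ κ.rev ≠ κ then kwSgn κ else 0 := rfl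

/-- `(√3)² = 3` in `ℂ`. [folklore] -/
theorem sqrt3_mul_self : (((Real.sqrt 3 : ℝ) : ℂ)) * ((Real.sqrt 3 : ℝ) : ℂ) = 3 := by
  rw [← Complex.ofReal_mul, Real.mul_self_sqrt (by norm_num : (0:ℝ) ≤ 3)]
  norm_num

/-- `∑_j β_j^† β_j = 3·1`: `∑_j ∑_κ conj(β_j(κ,ν)) β_j(κ,ν₂) = 3·[ν = ν₂]`. [folklore] -/
theorem kwBeta_frame (ν ν₂ : Fin n) :
    ∑ j : Fin (2 * 1 + 1), ∑ κ, conj (kwBeta κ ν j) * kwBeta κ ν₂ j = if ν = ν₂ then 3 else 0 := by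
  classical
  rw [Fin.sum_univ_three]
  simp only [kwBeta_zero, kwBeta_one, kwBeta_two]
  -- j = 0
  have h0 : ∑ κ : Fin n, conj (if κ = ν then (if κ.rev = κ then ((Real.sqrt 3 : ℝ) : ℂ) else 1) else 0) *
      (if κ = ν₂ then (if κ.rev = κ then ((Real.sqrt 3 : ℝ) : ℂ) else 1) else 0) =
      if ν = ν₂ then (if ν.rev = ν then 3 else 1) else 0 := by
    rw [Finset.sum_eq_single ν]
    · rw [if_pos rfl]
      by_cases h : ν = ν₂
      · subst h
        rw [if_pos rfl, if_pos rfl]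
        split_ifs <;> simp [sqrt3_mul_self]
      · rw [if_neg h, if_neg h, mul_zero]
    · intro κ _ hκ; rw [if_neg hκ]; simp
    · intro h; exact absurd (Finset.mem_univ ν) h
  -- j = 1
  have h1 : ∑ κ : Fin n, conj (if ν = κ.rev ∧ κ.rev ≠ κ then (1:ℂ) else 0) *
      (if ν₂ = κ.rev ∧ κ.rev ≠ κ then (1:ℂ) else 0) =
      if ν = ν₂ then (if ν.rev = ν then 0 else 1) else 0 := by
    rw [Finset.sum_eq_single ν.rev]
    · rw [Fin.rev_rev]
      by_cases h : ν = ν₂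
      · subst h
        by_cases hr : ν.rev = ν
        · have : ¬ (ν = ν ∧ ν ≠ ν.rev) := fun h' => h'.2 hr.symm
          rw [if_neg this, if_pos rfl, if_pos hr]; simp
        · have hr' : ν ≠ ν.rev := fun e => hr e.symm
          rw [if_pos ⟨rfl, hr'⟩, if_pos rfl, if_neg hr]; simp
      · rw [if_neg h]
        have : ¬ (ν₂ = ν ∧ ν ≠ ν.rev) := fun h' => h h'.1.symm
        rw [if_neg this, mul_zero]
    · intro κ _ hκ
      rw [if_neg]; · simp
      rintro ⟨e, -⟩; apply hκ; rw [e, Fin.rev_rev]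
    · intro h; exact absurd (Finset.mem_univ _) h
  -- j = 2
  have h2 : ∑ κ : Fin n, conj (if κ = ν ∧ κ.rev ≠ κ then kwSgn κ else 0) *
      (if κ = ν₂ ∧ κ.rev ≠ κ then kwSgn κ else 0) =
      if ν = ν₂ then (if ν.rev = ν then 0 else 1) else 0 := by
    rw [Finset.sum_eq_single ν]
    · by_cases h : ν = ν₂
      · subst h
        by_cases hr : ν.rev = ν
        · have : ¬ (ν = ν ∧ ν.rev ≠ ν) := fun h' => h'.2 hr
          rw [if_neg this, if_pos rfl, if_pos hr]; simp
        · rw [if_pos ⟨rfl, hr⟩, if_pos rfl, if_neg hr, conj_kwSgn, kwSgn_mul_self]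
      · rw [if_neg h]
        have : ¬ (ν = ν₂ ∧ ν.rev ≠ ν) := fun h' => h h'.1
        rw [if_neg this, mul_zero]
    · intro κ _ hκ
      have : ¬ (κ = ν ∧ κ.rev ≠ κ) := fun h' => hκ h'.1
      rw [if_neg this]; simp
    · intro h; exact absurd (Finset.mem_univ ν) h
  rw [h0, h1, h2]
  split_ifs <;> norm_num

/-! ## The projections `Φ_w` and the frame identity -/

/-- Coefficient matrix of `Φ_w = Φ ∘ (W_w ⊗ 1)`: `C_w(j, (κ',ν)) = ∑_κ β_j(κ,ν) W_w(κ,κ')`. [folklore] -/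
def kwCoeff [NeZero n] (w : Fin n × Fin n) : Matrix (Fin (2 * 1 + 1)) (Fin n × Fin n) ℂ :=
  Matrix.of fun j a => ∑ κ, kwBeta κ a.2 j * kwShift w κ a.1

/-- Entries of `C_w`. [folklore] -/
theorem kwCoeff_apply [NeZero n] (w : Fin n × Fin n) (j : Fin (2 * 1 + 1)) (a : Fin n × Fin n) :
    kwCoeff w j a = ∑ κ, kwBeta κ a.2 j * kwShift w κ a.1 := rfl

/-- The projection `Φ_w : ℂ^{n×n} → ℂ³`, `Φ_w(x)_j = ∑_a C_w(j,a) x_a`. [folklore] -/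
def kwProj [NeZero n] (w : Fin n × Fin n) : (Fin n × Fin n → ℂ) →ₗ[ℂ] (Fin (2 * 1 + 1) → ℂ) :=
  Matrix.mulVecLin (kwCoeff w)

/-- `Φ_w(x)_j = ∑_a C_w(j,a) x_a`. [folklore] -/
theorem kwProj_apply [NeZero n] (w : Fin n × Fin n) (x : Fin n × Fin n → ℂ) (j : Fin (2 * 1 + 1)) :
    kwProj w x j = ∑ a, kwCoeff w j a * x a := by
  simp [kwProj, Matrix.mulVec, dotProduct]

/-- The coefficient frame: `∑_w ∑_j conj(C_w(j,a)) C_w(j,a') = 3n·[a = a']`. [folklore] -/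
theorem kwCoeff_frame [NeZero n] (a a' : Fin n × Fin n) :
    ∑ w : Fin n × Fin n, ∑ j : Fin (2 * 1 + 1), conj (kwCoeff w j a) * kwCoeff w j a' =
      if a = a' then 3 * (n : ℂ) else 0 := by
  classical
  -- expand both coefficients
  have hexp : ∀ (w : Fin n × Fin n) (j : Fin (2 * 1 + 1)),
      conj (kwCoeff w j a) * kwCoeff w j a' =
        ∑ κ₀, ∑ κ₁, conj (kwBeta κ₀ a.2 j) * kwBeta κ₁ a'.2 j *
          (conj (kwShift w κ₀ a.1) * kwShift w κ₁ a'.1) := by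
    intro w j
    rw [kwCoeff_apply, kwCoeff_apply, map_sum, Finset.sum_mul_sum]
    refine Finset.sum_congr rfl fun κ₀ _ => Finset.sum_congr rfl fun κ₁ _ => ?_
    rw [map_mul]; ring
  simp_rw [hexp]
  -- move the sum over `w` inside
  rw [Finset.sum_comm]
  have hswap : ∀ j : Fin (2 * 1 + 1),
      ∑ w : Fin n × Fin n, ∑ κ₀, ∑ κ₁, conj (kwBeta κ₀ a.2 j) * kwBeta κ₁ a'.2 j *
          (conj (kwShift w κ₀ a.1) * kwShift w κ₁ a'.1) =
      ∑ κ₀, conj (kwBeta κ₀ a.2 j) * kwBeta κ₀ a'.2 j * (if a.1 = a'.1 then (n : ℂ) else 0) := by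
    intro j
    rw [Finset.sum_comm]
    refine Finset.sum_congr rfl fun κ₀ _ => ?_
    rw [Finset.sum_comm]
    have : ∀ κ₁, ∑ w : Fin n × Fin n, conj (kwBeta κ₀ a.2 j) * kwBeta κ₁ a'.2 j *
        (conj (kwShift w κ₀ a.1) * kwShift w κ₁ a'.1) =
        conj (kwBeta κ₀ a.2 j) * kwBeta κ₁ a'.2 j * (if κ₀ = κ₁ ∧ a.1 = a'.1 then (n : ℂ) else 0) := by
      intro κ₁
      rw [← Finset.mul_sum, kwShift_complete]
    simp_rw [this]
    rw [Finset.sum_eq_single κ₀]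
    · simp
    · intro κ₁ _ hκ
      rw [if_neg]; · simp
      rintro ⟨e, -⟩; exact hκ e.symm
    · intro h; exact absurd (Finset.mem_univ κ₀) h
  simp_rw [hswap]
  have hfac : (∑ j : Fin (2 * 1 + 1), ∑ κ₀, conj (kwBeta κ₀ a.2 j) * kwBeta κ₀ a'.2 j *
      (if a.1 = a'.1 then (n : ℂ) else 0)) =
      (∑ j : Fin (2 * 1 + 1), ∑ κ₀, conj (kwBeta κ₀ a.2 j) * kwBeta κ₀ a'.2 j) *
        (if a.1 = a'.1 then (n : ℂ) else 0) := by
    rw [Finset.sum_mul]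
    exact Finset.sum_congr rfl fun j _ => by rw [Finset.sum_mul]
  rw [hfac, kwBeta_frame]
  obtain ⟨a1, a2⟩ := a
  obtain ⟨a1', a2'⟩ := a'
  simp only [Prod.mk.injEq]
  by_cases h1 : a1 = a1' <;> by_cases h2 : a2 = a2' <;> simp [h1, h2]

/-- **The frame identity** (the twirl `(Φ_w)_w` is an `L²`-isometry up to the factor `3n`):
`∑_w ∑_j conj(Φ_w x)_j (Φ_w y)_j = 3n ∑_a conj(x a) y a`. [folklore] -/
theorem kwProj_frame {n : ℕ} [NeZero n] (x y : Fin n × Fin n → ℂ) :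
    ∑ w : Fin n × Fin n, ∑ j : Fin (2 * 1 + 1), conj (kwProj w x j) * kwProj w y j =
      3 * (n : ℂ) * ∑ a, conj (x a) * y a := by
  classical
  have hexp : ∀ (w : Fin n × Fin n) (j : Fin (2 * 1 + 1)), conj (kwProj w x j) * kwProj w y j =
      ∑ a, ∑ a', conj (x a) * y a' * (conj (kwCoeff w j a) * kwCoeff w j a') := by
    intro w j
    rw [kwProj_apply, kwProj_apply, map_sum, Finset.sum_mul_sum]
    refine Finset.sum_congr rfl fun a _ => Finset.sum_congr rfl fun a' _ => ?_
    rw [map_mul]; ring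
  simp_rw [hexp]
  -- move the sums over `w, j` inside
  have hswap : ∑ w : Fin n × Fin n, ∑ j : Fin (2 * 1 + 1), ∑ a, ∑ a',
      conj (x a) * y a' * (conj (kwCoeff w j a) * kwCoeff w j a') =
      ∑ a, ∑ a', conj (x a) * y a' *
        ∑ w : Fin n × Fin n, ∑ j : Fin (2 * 1 + 1), conj (kwCoeff w j a) * kwCoeff w j a' := by
    have step1 : ∀ w : Fin n × Fin n, ∑ j : Fin (2 * 1 + 1), ∑ a, ∑ a',
        conj (x a) * y a' * (conj (kwCoeff w j a) * kwCoeff w j a') =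
        ∑ a, ∑ a', ∑ j : Fin (2 * 1 + 1), conj (x a) * y a' * (conj (kwCoeff w j a) * kwCoeff w j a') := by
      intro w
      rw [Finset.sum_comm]
      exact Finset.sum_congr rfl fun a _ => Finset.sum_comm
    simp_rw [step1]
    rw [Finset.sum_comm]
    refine Finset.sum_congr rfl fun a _ => ?_
    rw [Finset.sum_comm]
    refine Finset.sum_congr rfl fun a' _ => ?_
    rw [Finset.mul_sum]
    exact Finset.sum_congr rfl fun w _ => by rw [Finset.mul_sum]
  rw [hswap]
  simp_rw [kwCoeff_frame]
  simp only [mul_ite, mul_zero, Finset.sum_ite_eq, Finset.mem_univ, if_true]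
  rw [Finset.mul_sum]
  exact Finset.sum_congr rfl fun a _ => by ring

end Summit.MatrixMultiplication.MatrixMultiplication.Theorems.DiagonalPowerDecay

end
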